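import Literature.NumberTheory.Rogawski1990.TamagawaSingularMembersFinTFCovol   -- ★ p844690: the letters' FRAME and κ-block vocabulary (`CanonicalTransferMatrix`, `ArchCanonicalSingularMatrix`, …)
import Literature.NumberTheory.Weil1982.UnitaryFinCentralizerTopFormHaar         -- ★ p850468 `UnitaryFinTopForm.finTamagawaPartner` (|ω|_v-Tamagawa partners, X2♮'s (Q^ω))
import Literature.NumberTheory.Rogawski1990.FinExplicitTransferFactorConjLeft     -- ★ `finExplicitDelta_conj_left_all`  (explicit collection `Δ‴`, H-side conjugation invariance)
import Literature.NumberTheory.Rogawski1990.FinExplicitTransferFactorConjRight    -- ★ `finExplicitDelta_conj_right_all` (G-side)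
import Literature.NumberTheory.Rogawski1990.ArchCanonicalTransferFactor           -- ★ `archCanonicalTransferFactor` = `Δ‴_∞ = c(H′)·Δ″_∞`
import Literature.NumberTheory.Rogawski1990.ExplicitFactorProductFormula          -- ★ `satisfiesProductFormula_finExplicitCollection` + the three reciprocity laws; `UnitaryGroup.PlacesOver` idiom
import Literature.NumberTheory.Automorphic.QuadraticHeckeCharacterCM              -- ★ `quadraticHeckeCharCM` = `ω_{L∕L⁺}` (the μ-GUARD of print's endoscopic datum, as in the P3a line)
import Literature.NumberTheory.Rogawski1990.SingularLocalOrbitSeparation              -- ★ `exists_isCompact_isOpen_forall_isStablyConj_imp_isConj`, `localStableOrbitalIntegral_indicator_ne_zero_of_sep` (SEP + indicator witness)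
import Literature.NumberTheory.Rogawski1990.AdelicStableOrbitalEulerDischargeSemisimple  -- ★ `mul_sub_smul_toLocal_toAdelic_eq_zero`, `isUnit_algebraMap_localRing_sub` (localisation of `(γ₀ − e₁)(γ₀ − e₂) = 0`)
import Literature.NumberTheory.Rogawski1990.TamagawaSingularKappaBlockTransport           -- ★ `not_isRegularElt_of_charpoly_eq_sq_mul` (the κ-block's `γ₀` is a guard point of (Q-fin))
import HarnessLib

/-!
# K2 · E4∕E3 junction — `Theorems/K2E3StableDistributionSingular.lean`: the |ω|_v-Tamagawa stable orbital integral at the singular `γ_{0,v}` is a NONZERO functional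
(Rogawski 1990, Prop. 8.1.4 p. 117 (= Kottwitz 1988, Prop. 1); §4.9 Prop. 4.9.1 (a) pp. 54–55; §4.1 (4.1.1) p. 39)

HCML Track B «K2-LIT», cell `pub/hodgecm-mathlib`, crux H413 = `stmt-HodgeConjecture-24833` (`--supports`), seat `hodgecm-mathlib-K2E4-p06` (g0).
PAYS socket #6 `sig_K2E3StableDistributionSingular` :189 of the tier-1 module `Cruxes/H413/Lines/K2_E4_SingularTransferKappaSignSigsFinGermConstants.lean` ED. 2
(sha16 95b740eb89190ebf, commit f5c6660961f7; OWNER: K2E3 — junction, stated by consumer K2E4; dealt to this seat as #6 `FinSingularStableIntegralNonvanishing` in K2-lead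
SKELETON LANDED l.72384, renamed by the chair's (Q-p06-1) answer 21:02:35Z «tree wins») BY NAME.  The frame (`variable` block) and the statement are pasted VERBATIM from
the socket module; the head theorem is `stableDistributionSingular`; the by-name tie `example : type_of% @….K2E3StableDistributionSingular.stableDistributionSingular =
type_of% @….K2E4SingularTransferKappaSign.FinGermConstants.sig_K2E3StableDistributionSingular := rfl` is checked in the seat's probe file (socket module BUILT 20:58Z) and
is re-done on the socket side when the planner re-issues the module importing this file.

THE MATHEMATICS (all inputs ★, nothing printed is consumed; PROOF STRATEGY = «indicator of a separating compact open set»).  Fix the frame, a (Q-fin) family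
`mGs₀` (★ `OrbitalMeasureFamily.IsQuotientOf`: on the classes corresponding to a NON-REGULAR rational point, `mGs₀ v [y] = dνG_v ∕ d(finTamagawaPartner y)`), the
κ-block's singular `γ₀ ∈ U(H′)(L⁺)` (`(γ₀ − e₁)(γ₀ − e₂) = 0`, `e₁ ≠ e₂`, `charpoly γ₀ = (X − e₁)²(X − e₂)`), and a finite place `v`; put `x := (γ₀)_v ∈ U(H′)(L⁺_v)`.
(1) `(x − e₁)(x − e₂) = 0` with `e₁ − e₂` a unit of `L ⊗ L⁺_v` (★ `mul_sub_smul_toLocal_toAdelic_eq_zero`, ★ `isUnit_algebraMap_localRing_sub`), and `det H′ ≠ 0`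
(`H′` anisotropic).  (2) ★ SEP `exists_isCompact_isOpen_forall_isStablyConj_imp_isConj`: a COMPACT OPEN `U ∋ x` meeting the stable class of `x` only inside the
class of `x`.  (3) `γ₀` is non-regular (★ `not_isRegularElt_of_charpoly_eq_sq_mul`) and `(γ₀)_v ↔ out [x]` (★ `Corresponds` = `IsStablyConj` for `H = H′`), so `[x]`
is a guarded class and `mGs₀ v` is ADMISSIBLE there — non-zero, `U(H′)(L⁺_v)`-invariant, finite on compacta (★ `IsQuotientOf.isAdmissibleOn`, `νG_v` Haar).
(4) `f := 1_U ∈ C_c^∞` (★ `isLocSmooth_indicator`) and `Φ^st(x, 1_U) = Φ([x], 1_U) > 0` (★ `localStableOrbitalIntegral_indicator_ne_zero_of_sep`).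
Print: «PROPOSITION 8.1.4: For all semisimple elements γ ∈ G, Φ^st(γ, f) is a stable distribution.» [Rogawski1990 p. 117] — the consumer form used by the
K2E4 line is only that this distribution is NOT ZERO at the singular `γ₀`, which is what is proved here (unconditionally, for every place `v`).
HONEST LABEL: HC_CM is proved only modulo the 7 printed citations (2 remaining named inputs: hLiu418 = stmt-HodgeConjecture-24832, h413 = stmt-HodgeConjecture-24833)
until rung 0 closes; this file is unconditional and proves no printed letter by itself.  No `sorry`, no axiom beyond the trio, no `def`, no instance, no notation.

## References
* [Rogawski1990] J. D. Rogawski, *Automorphic Representations of Unitary Groups in Three Variables*, Ann. of Math. Stud. 123 (1990): §4.1 (4.1.1) p. 39, §4.9 Prop.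
  4.9.1 (a) pp. 54–55, §8.1 Prop. 8.1.4 p. 117, §8.2 Prop. 8.2.1 (a) p. 117.
* [DeitmarEchterhoff2014] A. Deitmar, S. Echterhoff, *Principles of Harmonic Analysis*, 2nd ed. (2014), Thm. 1.5.3 (invariant quotient measures).
* [GetzHahn2024] J. R. Getz, H. Hahn, *An Introduction to Automorphic Representations*, GTM 300 (2024), §17.3, Thm. 17.4.1.
-/

set_option autoImplicit false
set_option linter.dupNamespace false

noncomputable section

open MeasureTheory Measure NumberField IsDedekindDomain
open Literature.MeasureTheory.Group Literature.MeasureTheory.RestrictedProduct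
open Literature.Topology.RestrictedProduct Literature.Topology.Algebra.RestrictedProduct
open Literature.NumberTheory.Rogawski1990 Literature.NumberTheory.Automorphic
open Literature.AlgebraicGeometry.ShimuraVarieties (unitaryGroup hermForm)
open scoped Matrix MatrixGroups RestrictedProduct

namespace Summit.HodgeConjecture.HodgeConjecture.Cruxes.H413.K2E3StableDistributionSingular

/-- `H′` anisotropic ⟹ `det H′ ≠ 0` (a kernel vector would be isotropic) — private copy of the ★ letter (`TamagawaSingularFinPartners`, not exported there).
[cite: Rogawski1990, §3.8 p. 30] -/
private theorem det_ne_zero_of_anisotropic {L : Type} [Field L] [NumberField L] [IsCMField L] {H' : Matrix (Fin 3) (Fin 3) L}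
    (hanis : ∀ x : Fin 3 → L, hermForm (cmConjRingHom L) H' x x = 0 → x = 0) : H'.det ≠ 0 := by
  intro hdet
  obtain ⟨w, hw, hHw⟩ := Matrix.exists_mulVec_eq_zero_iff.mpr hdet
  refine hw (hanis w ?_)
  rw [hermForm, hHw, dotProduct_zero]

section Frame

variable (L : Type) [Field L] [NumberField L] [IsCMField L]

variable (H' : Matrix (Fin 3) (Fin 3) L) (Tinf : ArchTransferFactor L H')
    -- σ-algebras of the `G′` side (★ (O10-c5) block), of `H_v`, `G_∞`, `H_∞`, and the Haar data — EXACTLY ★ `SingularEllipticTransfer`'s binders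
    [∀ g : (UnitaryGroup.cmDatum L 3 H').Adelic, MeasurableSpace ((UnitaryGroup.cmDatum L 3 H').Adelic ⧸ Subgroup.centralizer ({g} : Set (UnitaryGroup.cmDatum L 3 H').Adelic))]
    [∀ g : (UnitaryGroup.cmDatum L 3 H').Adelic, BorelSpace ((UnitaryGroup.cmDatum L 3 H').Adelic ⧸ Subgroup.centralizer ({g} : Set (UnitaryGroup.cmDatum L 3 H').Adelic))]
    [∀ γ : UnitaryGroup.arch (↥(maximalRealSubfield L)) L (IsCMField.complexConj L) 3 H',
      MeasurableSpace (UnitaryGroup.arch (↥(maximalRealSubfield L)) L (IsCMField.complexConj L) 3 H' ⧸ Subgroup.centralizer ({γ} : Set (UnitaryGroup.arch (↥(maximalRealSubfield L)) L (IsCMField.complexConj L) 3 H')))]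
    [∀ γ : UnitaryGroup.arch (↥(maximalRealSubfield L)) L (IsCMField.complexConj L) 3 H',
      BorelSpace (UnitaryGroup.arch (↥(maximalRealSubfield L)) L (IsCMField.complexConj L) 3 H' ⧸ Subgroup.centralizer ({γ} : Set (UnitaryGroup.arch (↥(maximalRealSubfield L)) L (IsCMField.complexConj L) 3 H')))]
    [∀ (v : HeightOneSpectrum (𝓞 ↥(maximalRealSubfield L))) (γ : (UnitaryGroup.cmDatum L 3 H').Local v),
      MeasurableSpace ((UnitaryGroup.cmDatum L 3 H').Local v ⧸ Subgroup.centralizer ({γ} : Set ((UnitaryGroup.cmDatum L 3 H').Local v)))]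
    [∀ (v : HeightOneSpectrum (𝓞 ↥(maximalRealSubfield L))) (γ : (UnitaryGroup.cmDatum L 3 H').Local v),
      BorelSpace ((UnitaryGroup.cmDatum L 3 H').Local v ⧸ Subgroup.centralizer ({γ} : Set ((UnitaryGroup.cmDatum L 3 H').Local v)))]
    [∀ v : HeightOneSpectrum (𝓞 ↥(maximalRealSubfield L)), MeasurableSpace ((UnitaryGroup.cmDatum L 3 H').Local v)] [∀ v : HeightOneSpectrum (𝓞 ↥(maximalRealSubfield L)), BorelSpace ((UnitaryGroup.cmDatum L 3 H').Local v)]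
    [MeasurableSpace (UnitaryGroup.cmDatum L 3 H').Adelic] [BorelSpace (UnitaryGroup.cmDatum L 3 H').Adelic]
    [MeasurableSpace (UnitaryGroup.arch (↥(maximalRealSubfield L)) L (IsCMField.complexConj L) 3 H')] [BorelSpace (UnitaryGroup.arch (↥(maximalRealSubfield L)) L (IsCMField.complexConj L) 3 H')]
    [∀ γ : (UnitaryGroup.cmDatum L 3 H').Adelic, MeasurableSpace (↥(Subgroup.centralizer ({γ} : Set (UnitaryGroup.cmDatum L 3 H').Adelic)) ⧸
      ((UnitaryGroup.cmDatum L 3 H').quotientSubgroup ⊓ Subgroup.centralizer ({γ} : Set (UnitaryGroup.cmDatum L 3 H').Adelic)).subgroupOf (Subgroup.centralizer ({γ} : Set (UnitaryGroup.cmDatum L 3 H').Adelic)))]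
    [∀ γ : (UnitaryGroup.cmDatum L 3 H').Adelic, BorelSpace (↥(Subgroup.centralizer ({γ} : Set (UnitaryGroup.cmDatum L 3 H').Adelic)) ⧸
      ((UnitaryGroup.cmDatum L 3 H').quotientSubgroup ⊓ Subgroup.centralizer ({γ} : Set (UnitaryGroup.cmDatum L 3 H').Adelic)).subgroupOf (Subgroup.centralizer ({γ} : Set (UnitaryGroup.cmDatum L 3 H').Adelic)))]
    [hCcl : ∀ γ : (UnitaryGroup.cmDatum L 3 H').Adelic, IsClosed ((Subgroup.centralizer ({γ} : Set (UnitaryGroup.cmDatum L 3 H').Adelic) : Subgroup (UnitaryGroup.cmDatum L 3 H').Adelic) : Set (UnitaryGroup.cmDatum L 3 H').Adelic)]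
    [∀ γ : (UnitaryGroup.cmDatum L 3 H').Adelic, (count : Measure ↥(((UnitaryGroup.cmDatum L 3 H').quotientSubgroup ⊓ Subgroup.centralizer ({γ} : Set (UnitaryGroup.cmDatum L 3 H').Adelic)).subgroupOf
      (Subgroup.centralizer ({γ} : Set (UnitaryGroup.cmDatum L 3 H').Adelic)))).IsHaarMeasure]
    [∀ v : HeightOneSpectrum (𝓞 ↥(maximalRealSubfield L)), MeasurableSpace ((UnitaryGroup.cmDatum L 2 (Matrix.of fun i j : Fin 2 => if i.val + j.val + 1 = 2 then (1 : L) else 0)).Local v ×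
        (UnitaryGroup.cmDatum L 1 (Matrix.of fun i j : Fin 1 => if i.val + j.val + 1 = 1 then (1 : L) else 0)).Local v)]
    [∀ v : HeightOneSpectrum (𝓞 ↥(maximalRealSubfield L)), BorelSpace ((UnitaryGroup.cmDatum L 2 (Matrix.of fun i j : Fin 2 => if i.val + j.val + 1 = 2 then (1 : L) else 0)).Local v ×
        (UnitaryGroup.cmDatum L 1 (Matrix.of fun i j : Fin 1 => if i.val + j.val + 1 = 1 then (1 : L) else 0)).Local v)]
    [∀ (v : HeightOneSpectrum (𝓞 ↥(maximalRealSubfield L))) (a : ((UnitaryGroup.cmDatum L 2 (Matrix.of fun i j : Fin 2 => if i.val + j.val + 1 = 2 then (1 : L) else 0)).Local v ×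
        (UnitaryGroup.cmDatum L 1 (Matrix.of fun i j : Fin 1 => if i.val + j.val + 1 = 1 then (1 : L) else 0)).Local v)),
      MeasurableSpace (((UnitaryGroup.cmDatum L 2 (Matrix.of fun i j : Fin 2 => if i.val + j.val + 1 = 2 then (1 : L) else 0)).Local v ×
        (UnitaryGroup.cmDatum L 1 (Matrix.of fun i j : Fin 1 => if i.val + j.val + 1 = 1 then (1 : L) else 0)).Local v) ⧸ Subgroup.centralizer ({a} : Set ((UnitaryGroup.cmDatum L 2 (Matrix.of fun i j : Fin 2 => if i.val + j.val + 1 = 2 then (1 : L) else 0)).Local v ×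
        (UnitaryGroup.cmDatum L 1 (Matrix.of fun i j : Fin 1 => if i.val + j.val + 1 = 1 then (1 : L) else 0)).Local v)))]
    [∀ (v : HeightOneSpectrum (𝓞 ↥(maximalRealSubfield L))) (a : ((UnitaryGroup.cmDatum L 2 (Matrix.of fun i j : Fin 2 => if i.val + j.val + 1 = 2 then (1 : L) else 0)).Local v ×
        (UnitaryGroup.cmDatum L 1 (Matrix.of fun i j : Fin 1 => if i.val + j.val + 1 = 1 then (1 : L) else 0)).Local v)),
      BorelSpace (((UnitaryGroup.cmDatum L 2 (Matrix.of fun i j : Fin 2 => if i.val + j.val + 1 = 2 then (1 : L) else 0)).Local v ×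
        (UnitaryGroup.cmDatum L 1 (Matrix.of fun i j : Fin 1 => if i.val + j.val + 1 = 1 then (1 : L) else 0)).Local v) ⧸ Subgroup.centralizer ({a} : Set ((UnitaryGroup.cmDatum L 2 (Matrix.of fun i j : Fin 2 => if i.val + j.val + 1 = 2 then (1 : L) else 0)).Local v ×
        (UnitaryGroup.cmDatum L 1 (Matrix.of fun i j : Fin 1 => if i.val + j.val + 1 = 1 then (1 : L) else 0)).Local v)))]
    [MeasurableSpace (UnitaryGroup.arch (↥(maximalRealSubfield L)) L (IsCMField.complexConj L) 3 (Matrix.of fun i j : Fin 3 => if i.val + j.val + 1 = 3 then (1 : L) else 0))] [BorelSpace (UnitaryGroup.arch (↥(maximalRealSubfield L)) L (IsCMField.complexConj L) 3 (Matrix.of fun i j : Fin 3 => if i.val + j.val + 1 = 3 then (1 : L) else 0))]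
    [∀ γ : UnitaryGroup.arch (↥(maximalRealSubfield L)) L (IsCMField.complexConj L) 3 (Matrix.of fun i j : Fin 3 => if i.val + j.val + 1 = 3 then (1 : L) else 0),
      MeasurableSpace (UnitaryGroup.arch (↥(maximalRealSubfield L)) L (IsCMField.complexConj L) 3 (Matrix.of fun i j : Fin 3 => if i.val + j.val + 1 = 3 then (1 : L) else 0) ⧸ Subgroup.centralizer ({γ} : Set (UnitaryGroup.arch (↥(maximalRealSubfield L)) L (IsCMField.complexConj L) 3 (Matrix.of fun i j : Fin 3 => if i.val + j.val + 1 = 3 then (1 : L) else 0))))]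
    [∀ γ : UnitaryGroup.arch (↥(maximalRealSubfield L)) L (IsCMField.complexConj L) 3 (Matrix.of fun i j : Fin 3 => if i.val + j.val + 1 = 3 then (1 : L) else 0),
      BorelSpace (UnitaryGroup.arch (↥(maximalRealSubfield L)) L (IsCMField.complexConj L) 3 (Matrix.of fun i j : Fin 3 => if i.val + j.val + 1 = 3 then (1 : L) else 0) ⧸ Subgroup.centralizer ({γ} : Set (UnitaryGroup.arch (↥(maximalRealSubfield L)) L (IsCMField.complexConj L) 3 (Matrix.of fun i j : Fin 3 => if i.val + j.val + 1 = 3 then (1 : L) else 0))))]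
    [MeasurableSpace (UnitaryGroup.arch (↥(maximalRealSubfield L)) L (IsCMField.complexConj L) 2 (Matrix.of fun i j : Fin 2 => if i.val + j.val + 1 = 2 then (1 : L) else 0) ×
          UnitaryGroup.arch (↥(maximalRealSubfield L)) L (IsCMField.complexConj L) 1 (Matrix.of fun i j : Fin 1 => if i.val + j.val + 1 = 1 then (1 : L) else 0))]
    [BorelSpace (UnitaryGroup.arch (↥(maximalRealSubfield L)) L (IsCMField.complexConj L) 2 (Matrix.of fun i j : Fin 2 => if i.val + j.val + 1 = 2 then (1 : L) else 0) ×
          UnitaryGroup.arch (↥(maximalRealSubfield L)) L (IsCMField.complexConj L) 1 (Matrix.of fun i j : Fin 1 => if i.val + j.val + 1 = 1 then (1 : L) else 0))]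
    [∀ a : (UnitaryGroup.arch (↥(maximalRealSubfield L)) L (IsCMField.complexConj L) 2 (Matrix.of fun i j : Fin 2 => if i.val + j.val + 1 = 2 then (1 : L) else 0) ×
          UnitaryGroup.arch (↥(maximalRealSubfield L)) L (IsCMField.complexConj L) 1 (Matrix.of fun i j : Fin 1 => if i.val + j.val + 1 = 1 then (1 : L) else 0)),
      MeasurableSpace ((UnitaryGroup.arch (↥(maximalRealSubfield L)) L (IsCMField.complexConj L) 2 (Matrix.of fun i j : Fin 2 => if i.val + j.val + 1 = 2 then (1 : L) else 0) ×
          UnitaryGroup.arch (↥(maximalRealSubfield L)) L (IsCMField.complexConj L) 1 (Matrix.of fun i j : Fin 1 => if i.val + j.val + 1 = 1 then (1 : L) else 0)) ⧸ Subgroup.centralizer ({a} : Set (UnitaryGroup.arch (↥(maximalRealSubfield L)) L (IsCMField.complexConj L) 2 (Matrix.of fun i j : Fin 2 => if i.val + j.val + 1 = 2 then (1 : L) else 0) ×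
          UnitaryGroup.arch (↥(maximalRealSubfield L)) L (IsCMField.complexConj L) 1 (Matrix.of fun i j : Fin 1 => if i.val + j.val + 1 = 1 then (1 : L) else 0))))]
    [∀ a : (UnitaryGroup.arch (↥(maximalRealSubfield L)) L (IsCMField.complexConj L) 2 (Matrix.of fun i j : Fin 2 => if i.val + j.val + 1 = 2 then (1 : L) else 0) ×
          UnitaryGroup.arch (↥(maximalRealSubfield L)) L (IsCMField.complexConj L) 1 (Matrix.of fun i j : Fin 1 => if i.val + j.val + 1 = 1 then (1 : L) else 0)),
      BorelSpace ((UnitaryGroup.arch (↥(maximalRealSubfield L)) L (IsCMField.complexConj L) 2 (Matrix.of fun i j : Fin 2 => if i.val + j.val + 1 = 2 then (1 : L) else 0) ×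
          UnitaryGroup.arch (↥(maximalRealSubfield L)) L (IsCMField.complexConj L) 1 (Matrix.of fun i j : Fin 1 => if i.val + j.val + 1 = 1 then (1 : L) else 0)) ⧸ Subgroup.centralizer ({a} : Set (UnitaryGroup.arch (↥(maximalRealSubfield L)) L (IsCMField.complexConj L) 2 (Matrix.of fun i j : Fin 2 => if i.val + j.val + 1 = 2 then (1 : L) else 0) ×
          UnitaryGroup.arch (↥(maximalRealSubfield L)) L (IsCMField.complexConj L) 1 (Matrix.of fun i j : Fin 1 => if i.val + j.val + 1 = 1 then (1 : L) else 0))))]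
    (νH : ∀ v : HeightOneSpectrum (𝓞 ↥(maximalRealSubfield L)), Measure ((UnitaryGroup.cmDatum L 2 (Matrix.of fun i j : Fin 2 => if i.val + j.val + 1 = 2 then (1 : L) else 0)).Local v ×
        (UnitaryGroup.cmDatum L 1 (Matrix.of fun i j : Fin 1 => if i.val + j.val + 1 = 1 then (1 : L) else 0)).Local v))
    (νG : ∀ v : HeightOneSpectrum (𝓞 ↥(maximalRealSubfield L)), Measure ((UnitaryGroup.cmDatum L 3 H').Local v))
    [∀ v, IsFiniteMeasureOnCompacts (νH v)] [∀ v, (νH v).IsMulRightInvariant]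
    [∀ v, (νG v).IsHaarMeasure] [∀ v, (νG v).IsMulRightInvariant]  -- MAIN-b's strength (F2): `νG_v` Haar
    (νGi : Measure (UnitaryGroup.arch (↥(maximalRealSubfield L)) L (IsCMField.complexConj L) 3 H')) (νqi : Measure (UnitaryGroup.arch (↥(maximalRealSubfield L)) L (IsCMField.complexConj L) 3 (Matrix.of fun i j : Fin 3 => if i.val + j.val + 1 = 3 then (1 : L) else 0)))
    (νHi : Measure (UnitaryGroup.arch (↥(maximalRealSubfield L)) L (IsCMField.complexConj L) 2 (Matrix.of fun i j : Fin 2 => if i.val + j.val + 1 = 2 then (1 : L) else 0) ×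
          UnitaryGroup.arch (↥(maximalRealSubfield L)) L (IsCMField.complexConj L) 1 (Matrix.of fun i j : Fin 1 => if i.val + j.val + 1 = 1 then (1 : L) else 0)))
    [IsFiniteMeasureOnCompacts νGi] [νGi.IsMulRightInvariant] [IsFiniteMeasureOnCompacts νqi] [νqi.IsMulRightInvariant]
    [IsFiniteMeasureOnCompacts νHi] [νHi.IsMulRightInvariant]


set_option linter.unusedSectionVars false in  -- the frame's auto-included instance binders are part of the socket's TYPE (bytes frozen); `omit` would change the type and break the `rfl` tie
/-- **`stableDistributionSingular`** = socket #6 `sig_K2E3StableDistributionSingular` (ED. 2 :189; ed. 1 name `sig_K2E4FinSingularStableIntegralNonvanishing`) of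
`Cruxes/H413/Lines/K2_E4_SingularTransferKappaSignSigsFinGermConstants.lean`, TOKEN FOR TOKEN: under the letters' frame, for every (Q-fin) family `mGs₀` (Weil quotients
of the Haar measures `νG_v` by the |ω|_v-Tamagawa partners on the classes through a non-regular rational point), the κ-block's singular `γ₀` and EVERY finite place `v`,
there is `f ∈ C_c^∞(U(H′)(L⁺_v))` with `Φ^st((γ₀)_v, f) ≠ 0` — the stable distribution `Φ^st(γ₀, ·)` of [Rogawski1990, Prop. 8.1.4] is NOT the zero functional.
Witness: `f = 1_U` for a compact open `U ∋ (γ₀)_v` separating the class of `(γ₀)_v` from the rest of its stable class (module docstring (1)–(4)).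
[cite: Rogawski1990, Prop. 8.1.4 p. 117] [cite: Rogawski1990, §4.9 Prop. 4.9.1 (a) pp. 54–55] [cite: Rogawski1990, §4.1 (4.1.1) p. 39] [cite: DeitmarEchterhoff2014, Thm. 1.5.3] -/
theorem stableDistributionSingular :
        ∀ (hK : ∀ v : HeightOneSpectrum (𝓞 ↥(maximalRealSubfield L)), νG v (UnitaryGroup.cmLocalIntegralLevel L 3 H' v : Set ((UnitaryGroup.cmDatum L 3 H').Local v)) = 1)
          (hanis : ∀ x : Fin 3 → L, hermForm (cmConjRingHom L) H' x x = 0 → x = 0)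
          (Sbad : Finset (HeightOneSpectrum (𝓞 ↥(maximalRealSubfield L))))
              (Δ : ∀ v : HeightOneSpectrum (𝓞 ↥(maximalRealSubfield L)), LocalTransferFactor L H' v)
              (mH : ∀ v : HeightOneSpectrum (𝓞 ↥(maximalRealSubfield L)),
                OrbitalMeasureFamily ((UnitaryGroup.cmDatum L 2 (Matrix.of fun i j : Fin 2 => if i.val + j.val + 1 = 2 then (1 : L) else 0)).Local v ×
                  (UnitaryGroup.cmDatum L 1 (Matrix.of fun i j : Fin 1 => if i.val + j.val + 1 = 1 then (1 : L) else 0)).Local v))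
              (mG : ∀ v : HeightOneSpectrum (𝓞 ↥(maximalRealSubfield L)), OrbitalMeasureFamily ((UnitaryGroup.cmDatum L 3 H').Local v))
          (m' : OrbitalMeasureFamily (UnitaryGroup.arch (↥(maximalRealSubfield L)) L (IsCMField.complexConj L) 3 H'))
                (m : OrbitalMeasureFamily (UnitaryGroup.arch (↥(maximalRealSubfield L)) L (IsCMField.complexConj L) 3
                  (Matrix.of fun i j : Fin 3 => if i.val + j.val + 1 = 3 then (1 : L) else 0)))
                (mHi : OrbitalMeasureFamily (UnitaryGroup.arch (↥(maximalRealSubfield L)) L (IsCMField.complexConj L) 2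
                    (Matrix.of fun i j : Fin 2 => if i.val + j.val + 1 = 2 then (1 : L) else 0) ×
                  UnitaryGroup.arch (↥(maximalRealSubfield L)) L (IsCMField.complexConj L) 1
                    (Matrix.of fun i j : Fin 1 => if i.val + j.val + 1 = 1 then (1 : L) else 0)))
                (t' : ∀ γ' : UnitaryGroup.arch (↥(maximalRealSubfield L)) L (IsCMField.complexConj L) 3 H',
                  Measure (Subgroup.centralizer ({γ'} : Set (UnitaryGroup.arch (↥(maximalRealSubfield L)) L (IsCMField.complexConj L) 3 H'))))
                (t : ∀ γ : UnitaryGroup.arch (↥(maximalRealSubfield L)) L (IsCMField.complexConj L) 3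
                    (Matrix.of fun i j : Fin 3 => if i.val + j.val + 1 = 3 then (1 : L) else 0),
                  Measure (Subgroup.centralizer ({γ} : Set (UnitaryGroup.arch (↥(maximalRealSubfield L)) L (IsCMField.complexConj L) 3
                    (Matrix.of fun i j : Fin 3 => if i.val + j.val + 1 = 3 then (1 : L) else 0)))))
                (tH : ∀ γH : UnitaryGroup.arch (↥(maximalRealSubfield L)) L (IsCMField.complexConj L) 2
                      (Matrix.of fun i j : Fin 2 => if i.val + j.val + 1 = 2 then (1 : L) else 0) ×
                    UnitaryGroup.arch (↥(maximalRealSubfield L)) L (IsCMField.complexConj L) 1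
                      (Matrix.of fun i j : Fin 1 => if i.val + j.val + 1 = 1 then (1 : L) else 0),
                  Measure (Subgroup.centralizer ({γH} : Set (UnitaryGroup.arch (↥(maximalRealSubfield L)) L (IsCMField.complexConj L) 2
                      (Matrix.of fun i j : Fin 2 => if i.val + j.val + 1 = 2 then (1 : L) else 0) ×
                    UnitaryGroup.arch (↥(maximalRealSubfield L)) L (IsCMField.complexConj L) 1
                      (Matrix.of fun i j : Fin 1 => if i.val + j.val + 1 = 1 then (1 : L) else 0)))))
            (hherm : (H'.map (cmConjRingHom L)).transpose = H')
            (hCTM : CanonicalTransferMatrix L H' Tinf.Δ νH νG Sbad Δ mH mG)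
            (hACS : ArchCanonicalSingularMatrix L H' Tinf νGi νqi νHi hanis m' m mHi t' t tH),
        ∀ (mGs₀ : ∀ v : HeightOneSpectrum (𝓞 ↥(maximalRealSubfield L)), OrbitalMeasureFamily ((UnitaryGroup.cmDatum L 3 H').Local v)),
          (∀ v, (mGs₀ v).IsQuotientOf (fun x : (UnitaryGroup.cmDatum L 3 H').Local v => ∃ γ₀ : (UnitaryGroup.cmDatum L 3 H').Rational, ¬ IsRegularElt (γ₀.val : GL (Fin 3) L) ∧
                Corresponds (UnitaryGroup.conjLocal L (IsCMField.complexConj L) v)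
                  ((UnitaryGroup.adelicForm L 3 H').map (UnitaryGroup.adeleToLocal L v))
                  ((UnitaryGroup.adelicForm L 3 H').map (UnitaryGroup.adeleToLocal L v))
                  ((UnitaryGroup.cmDatum L 3 H').toLocal v ((UnitaryGroup.cmDatum L 3 H').toAdelic γ₀)) x) (νG v) (Literature.NumberTheory.Weil1982.UnitaryFinTopForm.finTamagawaPartner L 3 H' v)) →
              ∀ (γ₀ : (UnitaryGroup.cmDatum L 3 H').Rational) (e₁ e₂ : L), e₁ ≠ e₂ →
                ((((γ₀ : unitaryGroup (cmConjRingHom L) H').val : GL (Fin 3) L) : Matrix (Fin 3) (Fin 3) L) - e₁ • (1 : Matrix (Fin 3) (Fin 3) L)) * ((((γ₀ : unitaryGroup (cmConjRingHom L) H').val : GL (Fin 3) L) : Matrix (Fin 3) (Fin 3) L) - e₂ • (1 : Matrix (Fin 3) (Fin 3) L)) = 0 →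
                (¬ ∃ ζ : L, (((γ₀ : unitaryGroup (cmConjRingHom L) H').val : GL (Fin 3) L) : Matrix (Fin 3) (Fin 3) L) = ζ • (1 : Matrix (Fin 3) (Fin 3) L)) →
                (((γ₀ : unitaryGroup (cmConjRingHom L) H').val : GL (Fin 3) L) : Matrix (Fin 3) (Fin 3) L).charpoly =
                  (Polynomial.X - Polynomial.C e₁) ^ 2 * (Polynomial.X - Polynomial.C e₂) →
                ∀ (γH : (UnitaryGroup.cmDatum L 2 (Matrix.of fun i j : Fin 2 => if i.val + j.val + 1 = 2 then (1 : L) else 0)).Rational ×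
                    (UnitaryGroup.cmDatum L 1 (Matrix.of fun i j : Fin 1 => if i.val + j.val + 1 = 1 then (1 : L) else 0)).Rational),
                  (((γH.1 : unitaryGroup (cmConjRingHom L) (Matrix.of fun i j : Fin 2 => if i.val + j.val + 1 = 2 then (1 : L) else 0)).val : GL (Fin 2) L) : Matrix (Fin 2) (Fin 2) L) =
                    e₁ • (1 : Matrix (Fin 2) (Fin 2) L) →
                  (((γH.2 : unitaryGroup (cmConjRingHom L) (Matrix.of fun i j : Fin 1 => if i.val + j.val + 1 = 1 then (1 : L) else 0)).val : GL (Fin 1) L) : Matrix (Fin 1) (Fin 1) L) 0 0 = e₂ →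
                  ∀ (v : HeightOneSpectrum (𝓞 ↥(maximalRealSubfield L))), ∃ f : (UnitaryGroup.cmDatum L 3 H').Local v → ℂ,
                    IsLocSmooth f ∧ localStableOrbitalIntegral L 3 H' v (mGs₀ v) f ((UnitaryGroup.cmDatum L 3 H').toLocal v ((UnitaryGroup.cmDatum L 3 H').toAdelic γ₀)) ≠ 0 := by
  intro hK hanis Sbad Δ mH mG m' m mHi t' t tH hherm hCTM hACS mGs₀ hQ γ₀ e₁ e₂ hne hprod hnc hchar γH hγH₁ hγH₂ v
  -- (1) the local point `x = (γ₀)_v`, its annihilator `(x − e₁)(x − e₂) = 0` with `e₁ − e₂` a unit, and `det H′ ≠ 0`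
  have hdet : H'.det ≠ 0 := det_ne_zero_of_anisotropic hanis
  have hab : IsUnit (algebraMap L (UnitaryGroup.LocalRing L v) e₁ - algebraMap L (UnitaryGroup.LocalRing L v) e₂) :=
    isUnit_algebraMap_localRing_sub v hne
  have hx := mul_sub_smul_toLocal_toAdelic_eq_zero (H := H') v γ₀ hprod
  -- (2) a compact open `U ∋ x` meeting the stable class of `x` only inside the class of `x`
  obtain ⟨U, hUc, hUo, hxU, hU⟩ := exists_isCompact_isOpen_forall_isStablyConj_imp_isConj L 3 H' v hherm hdet
    ((UnitaryGroup.cmDatum L 3 H').toLocal v ((UnitaryGroup.cmDatum L 3 H').toAdelic γ₀)) hab hx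
  -- (3) `[x]` is a guarded class of (Q-fin): `γ₀` is non-regular and `(γ₀)_v ↔ out [x]`; hence `mGs₀ v` is admissible at `[x]`
  have hout : IsConj ((UnitaryGroup.cmDatum L 3 H').toLocal v ((UnitaryGroup.cmDatum L 3 H').toAdelic γ₀))
      (Quotient.out (ConjClasses.mk ((UnitaryGroup.cmDatum L 3 H').toLocal v ((UnitaryGroup.cmDatum L 3 H').toAdelic γ₀)))) := by
    have h : ConjClasses.mk (Quotient.out (ConjClasses.mk ((UnitaryGroup.cmDatum L 3 H').toLocal v ((UnitaryGroup.cmDatum L 3 H').toAdelic γ₀)))) =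
        ConjClasses.mk ((UnitaryGroup.cmDatum L 3 H').toLocal v ((UnitaryGroup.cmDatum L 3 H').toAdelic γ₀)) := by
      rw [← ConjClasses.quotient_mk_eq_mk, Quotient.out_eq]
    exact (ConjClasses.mk_eq_mk_iff_isConj.1 h).symm
  have hP : ∃ γ₁ : (UnitaryGroup.cmDatum L 3 H').Rational, ¬ IsRegularElt (γ₁.val : GL (Fin 3) L) ∧
      Corresponds (UnitaryGroup.conjLocal L (IsCMField.complexConj L) v)
        ((UnitaryGroup.adelicForm L 3 H').map (UnitaryGroup.adeleToLocal L v))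
        ((UnitaryGroup.adelicForm L 3 H').map (UnitaryGroup.adeleToLocal L v))
        ((UnitaryGroup.cmDatum L 3 H').toLocal v ((UnitaryGroup.cmDatum L 3 H').toAdelic γ₁))
        (Quotient.out (ConjClasses.mk ((UnitaryGroup.cmDatum L 3 H').toLocal v ((UnitaryGroup.cmDatum L 3 H').toAdelic γ₀)))) :=
    ⟨γ₀, not_isRegularElt_of_charpoly_eq_sq_mul _ e₁ e₂ hchar, corresponds_self_iff.2 (isStablyConj_of_isConj hout)⟩
  obtain ⟨hm0, hinv, hfin⟩ := (hQ v).isAdmissibleOn _ hP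
  -- (4) the witness `f = 1_U`
  refine ⟨U.indicator fun _ => (1 : ℂ), isLocSmooth_indicator hUo hUc.isClosed hUc, ?_⟩
  exact localStableOrbitalIntegral_indicator_ne_zero_of_sep L 3 H' v hherm hdet hab hx hUo hUc hxU hU (mGs₀ v) hm0 hinv hfin _ (IsStablyConj.refl _)

set_option linter.unusedSectionVars false in  -- same frame, same reason as the head theorem (the frame's auto-included instance binders stay in the type)
/-- **`stableDistributionSingular_nonneg`** — «#6♯», the NONNEGATIVE-WITNESS form of socket #6 asked by the `pinFin` consumer (K2E4-p14, 2026-09-03): under the same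
frame and ∀-prefix as `stableDistributionSingular`, there is a REAL NONNEGATIVE `f ∈ C_c^∞(U(H′)(L⁺_v))` (`0 ≤ Re f`, `Im f = 0`; in fact `f = 1_U` is `{0,1}`-valued)
with `Φ^st((γ₀)_v, f) ≠ 0` — so every class orbital integral of `f` against an invariant family is `≥ 0`, which lets the consumer compare two (Q-fin)-type families
with DIFFERENT Haar ratios on the sheets (`Φ^st_m(γ, f) = ρ · Φ^st_{m₀}(γ, f)`, `ρ > 0`).  Same proof as the head theorem (separating compact open `U ∋ (γ₀)_v`,
★ `localStableOrbitalIntegral_indicator_ne_zero_of_sep`), recording the sign of the indicator.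
[cite: Rogawski1990, Prop. 8.1.4 p. 117] [cite: Rogawski1990, §4.9 Prop. 4.9.1 (a) pp. 54–55] [cite: DeitmarEchterhoff2014, Thm. 1.5.3] -/
theorem stableDistributionSingular_nonneg :
        ∀ (hK : ∀ v : HeightOneSpectrum (𝓞 ↥(maximalRealSubfield L)), νG v (UnitaryGroup.cmLocalIntegralLevel L 3 H' v : Set ((UnitaryGroup.cmDatum L 3 H').Local v)) = 1)
          (hanis : ∀ x : Fin 3 → L, hermForm (cmConjRingHom L) H' x x = 0 → x = 0)
          (Sbad : Finset (HeightOneSpectrum (𝓞 ↥(maximalRealSubfield L))))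
              (Δ : ∀ v : HeightOneSpectrum (𝓞 ↥(maximalRealSubfield L)), LocalTransferFactor L H' v)
              (mH : ∀ v : HeightOneSpectrum (𝓞 ↥(maximalRealSubfield L)),
                OrbitalMeasureFamily ((UnitaryGroup.cmDatum L 2 (Matrix.of fun i j : Fin 2 => if i.val + j.val + 1 = 2 then (1 : L) else 0)).Local v ×
                  (UnitaryGroup.cmDatum L 1 (Matrix.of fun i j : Fin 1 => if i.val + j.val + 1 = 1 then (1 : L) else 0)).Local v))
              (mG : ∀ v : HeightOneSpectrum (𝓞 ↥(maximalRealSubfield L)), OrbitalMeasureFamily ((UnitaryGroup.cmDatum L 3 H').Local v))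
          (m' : OrbitalMeasureFamily (UnitaryGroup.arch (↥(maximalRealSubfield L)) L (IsCMField.complexConj L) 3 H'))
                (m : OrbitalMeasureFamily (UnitaryGroup.arch (↥(maximalRealSubfield L)) L (IsCMField.complexConj L) 3
                  (Matrix.of fun i j : Fin 3 => if i.val + j.val + 1 = 3 then (1 : L) else 0)))
                (mHi : OrbitalMeasureFamily (UnitaryGroup.arch (↥(maximalRealSubfield L)) L (IsCMField.complexConj L) 2
                    (Matrix.of fun i j : Fin 2 => if i.val + j.val + 1 = 2 then (1 : L) else 0) ×
                  UnitaryGroup.arch (↥(maximalRealSubfield L)) L (IsCMField.complexConj L) 1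
                    (Matrix.of fun i j : Fin 1 => if i.val + j.val + 1 = 1 then (1 : L) else 0)))
                (t' : ∀ γ' : UnitaryGroup.arch (↥(maximalRealSubfield L)) L (IsCMField.complexConj L) 3 H',
                  Measure (Subgroup.centralizer ({γ'} : Set (UnitaryGroup.arch (↥(maximalRealSubfield L)) L (IsCMField.complexConj L) 3 H'))))
                (t : ∀ γ : UnitaryGroup.arch (↥(maximalRealSubfield L)) L (IsCMField.complexConj L) 3
                    (Matrix.of fun i j : Fin 3 => if i.val + j.val + 1 = 3 then (1 : L) else 0),
                  Measure (Subgroup.centralizer ({γ} : Set (UnitaryGroup.arch (↥(maximalRealSubfield L)) L (IsCMField.complexConj L) 3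
                    (Matrix.of fun i j : Fin 3 => if i.val + j.val + 1 = 3 then (1 : L) else 0)))))
                (tH : ∀ γH : UnitaryGroup.arch (↥(maximalRealSubfield L)) L (IsCMField.complexConj L) 2
                      (Matrix.of fun i j : Fin 2 => if i.val + j.val + 1 = 2 then (1 : L) else 0) ×
                    UnitaryGroup.arch (↥(maximalRealSubfield L)) L (IsCMField.complexConj L) 1
                      (Matrix.of fun i j : Fin 1 => if i.val + j.val + 1 = 1 then (1 : L) else 0),
                  Measure (Subgroup.centralizer ({γH} : Set (UnitaryGroup.arch (↥(maximalRealSubfield L)) L (IsCMField.complexConj L) 2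
                      (Matrix.of fun i j : Fin 2 => if i.val + j.val + 1 = 2 then (1 : L) else 0) ×
                    UnitaryGroup.arch (↥(maximalRealSubfield L)) L (IsCMField.complexConj L) 1
                      (Matrix.of fun i j : Fin 1 => if i.val + j.val + 1 = 1 then (1 : L) else 0)))))
            (hherm : (H'.map (cmConjRingHom L)).transpose = H')
            (hCTM : CanonicalTransferMatrix L H' Tinf.Δ νH νG Sbad Δ mH mG)
            (hACS : ArchCanonicalSingularMatrix L H' Tinf νGi νqi νHi hanis m' m mHi t' t tH),
        ∀ (mGs₀ : ∀ v : HeightOneSpectrum (𝓞 ↥(maximalRealSubfield L)), OrbitalMeasureFamily ((UnitaryGroup.cmDatum L 3 H').Local v)),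
          (∀ v, (mGs₀ v).IsQuotientOf (fun x : (UnitaryGroup.cmDatum L 3 H').Local v => ∃ γ₀ : (UnitaryGroup.cmDatum L 3 H').Rational, ¬ IsRegularElt (γ₀.val : GL (Fin 3) L) ∧
                Corresponds (UnitaryGroup.conjLocal L (IsCMField.complexConj L) v)
                  ((UnitaryGroup.adelicForm L 3 H').map (UnitaryGroup.adeleToLocal L v))
                  ((UnitaryGroup.adelicForm L 3 H').map (UnitaryGroup.adeleToLocal L v))
                  ((UnitaryGroup.cmDatum L 3 H').toLocal v ((UnitaryGroup.cmDatum L 3 H').toAdelic γ₀)) x) (νG v) (Literature.NumberTheory.Weil1982.UnitaryFinTopForm.finTamagawaPartner L 3 H' v)) →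
              ∀ (γ₀ : (UnitaryGroup.cmDatum L 3 H').Rational) (e₁ e₂ : L), e₁ ≠ e₂ →
                ((((γ₀ : unitaryGroup (cmConjRingHom L) H').val : GL (Fin 3) L) : Matrix (Fin 3) (Fin 3) L) - e₁ • (1 : Matrix (Fin 3) (Fin 3) L)) * ((((γ₀ : unitaryGroup (cmConjRingHom L) H').val : GL (Fin 3) L) : Matrix (Fin 3) (Fin 3) L) - e₂ • (1 : Matrix (Fin 3) (Fin 3) L)) = 0 →
                (¬ ∃ ζ : L, (((γ₀ : unitaryGroup (cmConjRingHom L) H').val : GL (Fin 3) L) : Matrix (Fin 3) (Fin 3) L) = ζ • (1 : Matrix (Fin 3) (Fin 3) L)) →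
                (((γ₀ : unitaryGroup (cmConjRingHom L) H').val : GL (Fin 3) L) : Matrix (Fin 3) (Fin 3) L).charpoly =
                  (Polynomial.X - Polynomial.C e₁) ^ 2 * (Polynomial.X - Polynomial.C e₂) →
                ∀ (γH : (UnitaryGroup.cmDatum L 2 (Matrix.of fun i j : Fin 2 => if i.val + j.val + 1 = 2 then (1 : L) else 0)).Rational ×
                    (UnitaryGroup.cmDatum L 1 (Matrix.of fun i j : Fin 1 => if i.val + j.val + 1 = 1 then (1 : L) else 0)).Rational),
                  (((γH.1 : unitaryGroup (cmConjRingHom L) (Matrix.of fun i j : Fin 2 => if i.val + j.val + 1 = 2 then (1 : L) else 0)).val : GL (Fin 2) L) : Matrix (Fin 2) (Fin 2) L) =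
                    e₁ • (1 : Matrix (Fin 2) (Fin 2) L) →
                  (((γH.2 : unitaryGroup (cmConjRingHom L) (Matrix.of fun i j : Fin 1 => if i.val + j.val + 1 = 1 then (1 : L) else 0)).val : GL (Fin 1) L) : Matrix (Fin 1) (Fin 1) L) 0 0 = e₂ →
                  ∀ (v : HeightOneSpectrum (𝓞 ↥(maximalRealSubfield L))), ∃ f : (UnitaryGroup.cmDatum L 3 H').Local v → ℂ,
                    IsLocSmooth f ∧ (∀ x, 0 ≤ (f x).re ∧ (f x).im = 0) ∧
                      localStableOrbitalIntegral L 3 H' v (mGs₀ v) f ((UnitaryGroup.cmDatum L 3 H').toLocal v ((UnitaryGroup.cmDatum L 3 H').toAdelic γ₀)) ≠ 0 := by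
  intro hK hanis Sbad Δ mH mG m' m mHi t' t tH hherm hCTM hACS mGs₀ hQ γ₀ e₁ e₂ hne hprod hnc hchar γH hγH₁ hγH₂ v
  -- (1)–(3) as in `stableDistributionSingular`
  have hdet : H'.det ≠ 0 := det_ne_zero_of_anisotropic hanis
  have hab : IsUnit (algebraMap L (UnitaryGroup.LocalRing L v) e₁ - algebraMap L (UnitaryGroup.LocalRing L v) e₂) :=
    isUnit_algebraMap_localRing_sub v hne
  have hx := mul_sub_smul_toLocal_toAdelic_eq_zero (H := H') v γ₀ hprod
  obtain ⟨U, hUc, hUo, hxU, hU⟩ := exists_isCompact_isOpen_forall_isStablyConj_imp_isConj L 3 H' v hherm hdet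
    ((UnitaryGroup.cmDatum L 3 H').toLocal v ((UnitaryGroup.cmDatum L 3 H').toAdelic γ₀)) hab hx
  have hout : IsConj ((UnitaryGroup.cmDatum L 3 H').toLocal v ((UnitaryGroup.cmDatum L 3 H').toAdelic γ₀))
      (Quotient.out (ConjClasses.mk ((UnitaryGroup.cmDatum L 3 H').toLocal v ((UnitaryGroup.cmDatum L 3 H').toAdelic γ₀)))) := by
    have h : ConjClasses.mk (Quotient.out (ConjClasses.mk ((UnitaryGroup.cmDatum L 3 H').toLocal v ((UnitaryGroup.cmDatum L 3 H').toAdelic γ₀)))) =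
        ConjClasses.mk ((UnitaryGroup.cmDatum L 3 H').toLocal v ((UnitaryGroup.cmDatum L 3 H').toAdelic γ₀)) := by
      rw [← ConjClasses.quotient_mk_eq_mk, Quotient.out_eq]
    exact (ConjClasses.mk_eq_mk_iff_isConj.1 h).symm
  have hP : ∃ γ₁ : (UnitaryGroup.cmDatum L 3 H').Rational, ¬ IsRegularElt (γ₁.val : GL (Fin 3) L) ∧
      Corresponds (UnitaryGroup.conjLocal L (IsCMField.complexConj L) v)
        ((UnitaryGroup.adelicForm L 3 H').map (UnitaryGroup.adeleToLocal L v))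
        ((UnitaryGroup.adelicForm L 3 H').map (UnitaryGroup.adeleToLocal L v))
        ((UnitaryGroup.cmDatum L 3 H').toLocal v ((UnitaryGroup.cmDatum L 3 H').toAdelic γ₁))
        (Quotient.out (ConjClasses.mk ((UnitaryGroup.cmDatum L 3 H').toLocal v ((UnitaryGroup.cmDatum L 3 H').toAdelic γ₀)))) :=
    ⟨γ₀, not_isRegularElt_of_charpoly_eq_sq_mul _ e₁ e₂ hchar, corresponds_self_iff.2 (isStablyConj_of_isConj hout)⟩
  obtain ⟨hm0, hinv, hfin⟩ := (hQ v).isAdmissibleOn _ hP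
  -- (4) the witness `f = 1_U` is real and `{0, 1}`-valued
  refine ⟨U.indicator fun _ => (1 : ℂ), isLocSmooth_indicator hUo hUc.isClosed hUc, fun y => ?_, ?_⟩
  · by_cases hy : y ∈ U
    · rw [Set.indicator_of_mem hy]
      exact ⟨zero_le_one, rfl⟩
    · rw [Set.indicator_of_notMem hy]
      exact ⟨le_rfl, rfl⟩
  · exact localStableOrbitalIntegral_indicator_ne_zero_of_sep L 3 H' v hherm hdet hab hx hUo hUc hxU hU (mGs₀ v) hm0 hinv hfin _ (IsStablyConj.refl _)

end Frame

end Summit.HodgeConjecture.HodgeConjecture.Cruxes.H413.K2E3StableDistributionSingular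

end
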